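import Mathlib
import Literature.RepresentationTheory.FiniteGroups.IrreducibleCharacters
import Summits.MatrixMultiplication.MatrixMultiplication.Theorems.LevelGradedCohnUmansGradedDesignFamilyStubWreathBudgetIndex

/-!
# Stub `stub_shareUniversality` for the line `Sketch` of `LevelGradedCohnUmans.GradedDesignFamily`

Host-free accounting ("splitting the wall is free"): shared-wall families — a fixed filling
fraction `c > 0` and, for every ratio `R`, a finite host `G` with a bi-invariant test space
`J ≤ ℂ^G`, wall `B₂ = Σ_{χ ∈ Irr G ∩ J} χ(1)² > 0`, `t ≥ 1` simultaneously `J`-separated pieces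
`(X_i, Y_i, Z_i)` each of volume `≥ c (B₂/t)^{3/2}`, and `R t χ(1)² ≤ B₂` for every visible
irreducible `χ` — yield, for every `ε > 0`, a graded simultaneous family at exponent `2 + ε`:
`Σ_{χ ∈ Irr G ∩ J} χ(1)^{2+ε} < Σ_i (|X_i| |Y_i| |Z_i|)^{(2+ε)/3}`.
The proof is power-mean bookkeeping: termwise `χ(1)^ε ≤ (B₂/(Rt))^{ε/2}`, so the graded budget
is `≤ B₂ (B₂/t)^{ε/2} R^{-ε/2}`, while the value is `≥ t c^{(2+ε)/3} (B₂/t)^{(2+ε)/2}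
= c^{(2+ε)/3} B₂ (B₂/t)^{ε/2}`; it remains to take `R` with `R^{-ε/2} < c^{(2+ε)/3}`.
[cite: CohnKleinbergSzegedyUmans2005, Thm. 5.5]
-/

noncomputable section

set_option linter.dupNamespace false

open scoped BigOperators
open Literature.RepresentationTheory.FiniteGroups

namespace Summit.MatrixMultiplication.MatrixMultiplication.Theorems.GradedDesignFamily

/-- Choice of the ratio: for `c > 0`, `ε > 0` there is `R > 0` with `R^{-ε/2} < c^{(2+ε)/3}`
(namely `R = (2 / c^{(2+ε)/3})^{2/ε}`, for which `R^{-ε/2} = c^{(2+ε)/3} / 2`). -/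
theorem shareUniversality_ratio {c ε : ℝ} (hc : 0 < c) (hε : 0 < ε) :
    ∃ R : ℝ, 0 < R ∧ R ^ (-(ε / 2)) < c ^ ((2 + ε) / 3) := by
  have hc' : 0 < c ^ ((2 + ε) / 3) := Real.rpow_pos_of_pos hc _
  have h2 : 0 < 2 / c ^ ((2 + ε) / 3) := div_pos two_pos hc'
  have hexp : 2 / ε * (-(ε / 2)) = -1 := by
    have hε0 : ε ≠ 0 := hε.ne'
    field_simp
  refine ⟨(2 / c ^ ((2 + ε) / 3)) ^ (2 / ε), Real.rpow_pos_of_pos h2 _, ?_⟩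
  rw [← Real.rpow_mul h2.le, hexp, Real.rpow_neg_one, inv_div]
  exact half_lt_self hc'

/-- Termwise budget bound: if `0 < d`, `d² ≤ M` and `0 ≤ e` then `d^{2+e} ≤ d² M^{e/2}`
(since `d^e = (d²)^{e/2} ≤ M^{e/2}`). -/
theorem shareUniversality_term_budget {d M e : ℝ} (hd : 0 < d) (hM : d ^ 2 ≤ M) (he : 0 ≤ e) :
    d ^ (2 + e) ≤ d ^ 2 * M ^ (e / 2) := by
  have h1 : d ^ (2 + e) = d ^ 2 * (d ^ 2) ^ (e / 2) := by
    rw [← Real.rpow_two, ← Real.rpow_mul hd.le, ← Real.rpow_add hd]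
    congr 1
    ring
  rw [h1]
  exact mul_le_mul_of_nonneg_left (Real.rpow_le_rpow (sq_nonneg d) hM (by linarith)) (sq_nonneg d)

/-- Termwise value bound: if `0 ≤ c`, `0 ≤ P`, `0 ≤ s` and `c P^{3/2} ≤ V` then
`c^{s/3} P^{s/2} ≤ V^{s/3}` (raise to the power `s/3`). -/
theorem shareUniversality_term_value {c P V s : ℝ} (hc : 0 ≤ c) (hP : 0 ≤ P) (hs : 0 ≤ s)
    (hV : c * P ^ (3 / 2 : ℝ) ≤ V) : c ^ (s / 3) * P ^ (s / 2) ≤ V ^ (s / 3) := by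
  have h0 : 0 ≤ c * P ^ (3 / 2 : ℝ) := mul_nonneg hc (Real.rpow_nonneg hP _)
  have h1 : (c * P ^ (3 / 2 : ℝ)) ^ (s / 3) = c ^ (s / 3) * P ^ (s / 2) := by
    rw [Real.mul_rpow hc (Real.rpow_nonneg hP _), ← Real.rpow_mul hP,
      show (3 / 2 : ℝ) * (s / 3) = s / 2 by ring]
  rw [← h1]
  exact Real.rpow_le_rpow h0 hV (div_nonneg hs (by norm_num))

/-- **The real-analytic core of `stub_shareUniversality`.**  A finite index set `S` with
"degrees" `d χ ≥ 1`, the wall `B = Σ_{χ ∈ S} (d χ)² > 0`, `t ≥ 1` "volumes"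
`V i ≥ c (B/t)^{3/2}` (`c > 0`), and a ratio `R > 0` with `R t (d χ)² ≤ B` on `S` and
`R^{-ε/2} < c^{(2+ε)/3}` (`ε > 0`) force `Σ_{χ ∈ S} (d χ)^{2+ε} < Σ_i (V i)^{(2+ε)/3}`.
[cite: CohnKleinbergSzegedyUmans2005, Thm. 5.5] -/
theorem shareUniversality_abstract {α : Type*} (S : Finset α) (d : α → ℝ) (t : ℕ)
    (V : Fin t → ℝ) (c R B ε : ℝ) (hc : 0 < c) (hε : 0 < ε) (hR : 0 < R)
    (hkey : R ^ (-(ε / 2)) < c ^ ((2 + ε) / 3)) (ht : 1 ≤ t)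
    (hB : B = ∑ χ ∈ S, d χ ^ (2 : ℝ)) (hB0 : 0 < B) (hd : ∀ χ ∈ S, 1 ≤ d χ)
    (hdeg : ∀ χ ∈ S, R * t * d χ ^ 2 ≤ B)
    (hvol : ∀ i : Fin t, c * (B / t) ^ (3 / 2 : ℝ) ≤ V i) :
    ∑ χ ∈ S, d χ ^ (2 + ε) < ∑ i : Fin t, V i ^ ((2 + ε) / 3) := by
  have htpos : (0 : ℝ) < t := Nat.cast_pos.mpr ht
  have hRt : 0 < R * t := mul_pos hR htpos
  have hPpos : 0 < B / t := div_pos hB0 htpos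
  have hB' : ∑ χ ∈ S, d χ ^ 2 = B := by
    rw [hB]
    exact Finset.sum_congr rfl fun χ _ => (Real.rpow_two _).symm
  -- (1) the graded budget is at most `B (B/(Rt))^{ε/2}`
  have hbud : ∑ χ ∈ S, d χ ^ (2 + ε) ≤ B * (B / (R * t)) ^ (ε / 2) := by
    calc ∑ χ ∈ S, d χ ^ (2 + ε) ≤ ∑ χ ∈ S, d χ ^ 2 * (B / (R * t)) ^ (ε / 2) := by
          refine Finset.sum_le_sum fun χ hχ => ?_
          exact shareUniversality_term_budget (one_pos.trans_le (hd χ hχ))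
            ((le_div_iff₀' hRt).mpr (hdeg χ hχ)) hε.le
      _ = B * (B / (R * t)) ^ (ε / 2) := by rw [← Finset.sum_mul, hB']
  -- (2) the value is at least `t c^{(2+ε)/3} (B/t)^{(2+ε)/2}`
  have hval : (t : ℝ) * (c ^ ((2 + ε) / 3) * (B / t) ^ ((2 + ε) / 2)) ≤
      ∑ i : Fin t, V i ^ ((2 + ε) / 3) := by
    calc (t : ℝ) * (c ^ ((2 + ε) / 3) * (B / t) ^ ((2 + ε) / 2))
          = ∑ _i : Fin t, c ^ ((2 + ε) / 3) * (B / t) ^ ((2 + ε) / 2) := by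
          rw [Finset.sum_const, Finset.card_univ, Fintype.card_fin, nsmul_eq_mul]
      _ ≤ ∑ i : Fin t, V i ^ ((2 + ε) / 3) := by
          refine Finset.sum_le_sum fun i _ => ?_
          exact shareUniversality_term_value hc.le hPpos.le (by linarith) (hvol i)
  -- (3) comparison of the two bounds
  have e1 : (B / (R * t)) ^ (ε / 2) = (B / t) ^ (ε / 2) * R ^ (-(ε / 2)) := by
    rw [Real.rpow_neg hR.le, ← Real.inv_rpow hR.le,
      ← Real.mul_rpow hPpos.le (inv_nonneg.mpr hR.le)]
    congr 1
    ring
  have e2 : (B / t) ^ ((2 + ε) / 2) = B / t * (B / t) ^ (ε / 2) := by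
    rw [show (2 + ε) / 2 = 1 + ε / 2 by ring, Real.rpow_add hPpos, Real.rpow_one]
  have htB : (t : ℝ) * (B / t) = B := by
    field_simp
  have hpos : 0 < B * (B / t) ^ (ε / 2) := mul_pos hB0 (Real.rpow_pos_of_pos hPpos _)
  calc ∑ χ ∈ S, d χ ^ (2 + ε) ≤ B * (B / (R * t)) ^ (ε / 2) := hbud
    _ = B * (B / t) ^ (ε / 2) * R ^ (-(ε / 2)) := by rw [e1, mul_assoc]
    _ < B * (B / t) ^ (ε / 2) * c ^ ((2 + ε) / 3) := mul_lt_mul_of_pos_left hkey hpos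
    _ = (t : ℝ) * (c ^ ((2 + ε) / 3) * (B / t) ^ ((2 + ε) / 2)) := by
        rw [e2]
        linear_combination ((B / t) ^ (ε / 2) * c ^ ((2 + ε) / 3)) * htB.symm
    _ ≤ ∑ i : Fin t, V i ^ ((2 + ε) / 3) := hval

/-- **stub_shareUniversality — splitting the wall among `t` pieces is free.**  Shared-wall
families (a fixed filling fraction `c > 0`; for every ratio `R` a finite host with a
bi-invariant `J`, `t ≥ 1` simultaneously `J`-separated pieces each of volume `≥ c (B₂/t)^{3/2}`,
`B₂ = Σ_{Irr∩J} d² > 0`, and `R t d² ≤ B₂` for every visible irreducible) give a graded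
simultaneous family at every exponent `2 + ε`, `ε > 0` (power means, host-free).
[cite: CohnKleinbergSzegedyUmans2005, Thm. 5.5] -/
theorem stub_shareUniversality (c : ℝ) (hc : 0 < c)
    (hfam : ∀ R : ℝ, ∃ (G : Type) (_ : Group G) (_ : Fintype G) (J : Submodule ℂ (G → ℂ))
      (B₂ : ℝ) (t : ℕ) (X Y Z : Fin t → Finset G),
      B₂ = (∑ᶠ χ ∈ Literature.RepresentationTheory.FiniteGroups.irrChars G ∩ (J : Set (G → ℂ)),
        (χ 1).re ^ (2 : ℝ)) ∧
      (∀ f ∈ J, ∀ a b : G, (fun g : G => f (a * g * b)) ∈ J) ∧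
      (∀ i : Fin t, ∀ x₀ ∈ X i, ∀ z₀ ∈ Z i, ∃ f ∈ J, ∀ j k : Fin t,
        ∀ x ∈ X j, ∀ y ∈ Y j, ∀ y' ∈ Y k, ∀ z ∈ Z k,
          ((j = i ∧ k = i ∧ x = x₀ ∧ y = y' ∧ z = z₀) → f (x⁻¹ * y * y'⁻¹ * z) = 1) ∧
          (¬ (j = i ∧ k = i ∧ x = x₀ ∧ y = y' ∧ z = z₀) → f (x⁻¹ * y * y'⁻¹ * z) = 0)) ∧
      1 ≤ t ∧ 0 < B₂ ∧
      (∀ i, c * (B₂ / t) ^ (3 / 2 : ℝ) ≤ ((((X i).card * (Y i).card * (Z i).card : ℕ) : ℝ))) ∧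
      (∀ χ ∈ Literature.RepresentationTheory.FiniteGroups.irrChars G ∩ (J : Set (G → ℂ)),
        R * t * (χ 1).re ^ 2 ≤ B₂))
    (ε : ℝ) (hε : 0 < ε) :
    ∃ (H : Type) (_ : Group H) (_ : Fintype H) (J : Submodule ℂ (H → ℂ)) (n : ℕ)
      (X Y Z : Fin n → Finset H),
      (∀ f ∈ J, ∀ a b : H, (fun g : H => f (a * g * b)) ∈ J) ∧
      (∀ i : Fin n, ∀ x₀ ∈ X i, ∀ z₀ ∈ Z i, ∃ f ∈ J, ∀ j k : Fin n,
        ∀ x ∈ X j, ∀ y ∈ Y j, ∀ y' ∈ Y k, ∀ z ∈ Z k,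
          ((j = i ∧ k = i ∧ x = x₀ ∧ y = y' ∧ z = z₀) → f (x⁻¹ * y * y'⁻¹ * z) = 1) ∧
          (¬ (j = i ∧ k = i ∧ x = x₀ ∧ y = y' ∧ z = z₀) → f (x⁻¹ * y * y'⁻¹ * z) = 0)) ∧
      (∑ᶠ χ ∈ Literature.RepresentationTheory.FiniteGroups.irrChars H ∩ (J : Set (H → ℂ)),
        (χ 1).re ^ (2 + ε)) <
        ∑ i, ((((X i).card * (Y i).card * (Z i).card : ℕ) : ℝ) ^ ((2 + ε) / 3)) := by
  obtain ⟨R, hRpos, hkey⟩ := shareUniversality_ratio hc hε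
  obtain ⟨G, _instG, _instF, J, B₂, t, X, Y, Z, hB, hJ, hsep, ht, hB0, hvol, hdeg⟩ := hfam R
  refine ⟨G, inferInstance, inferInstance, J, t, X, Y, Z, hJ, hsep, ?_⟩
  have hfin : (irrChars G ∩ (J : Set (G → ℂ))).Finite :=
    (irrChars_finite_holds G).subset Set.inter_subset_left
  rw [finsum_mem_eq_finite_toFinset_sum _ hfin] at hB
  rw [finsum_mem_eq_finite_toFinset_sum _ hfin]
  exact shareUniversality_abstract hfin.toFinset (fun χ => (χ 1).re) t
    (fun i => (((X i).card * (Y i).card * (Z i).card : ℕ) : ℝ)) c R B₂ ε hc hε hRpos hkey ht hB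
    hB0 (fun χ hχ => wreathBudget_one_le_re (hfin.mem_toFinset.mp hχ).1)
    (fun χ hχ => hdeg χ (hfin.mem_toFinset.mp hχ)) hvol

end Summit.MatrixMultiplication.MatrixMultiplication.Theorems.GradedDesignFamily

end
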